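import Literature.Analysis.FluidPDE.EmpiricalCollisionMeasureMeasurable
import HarnessLib

/-!
# `CollisionActivityTails` (stmt-AtomisticToContinuum-13734), line `SketchK1`: collision pair sums with
configuration-dependent summands are measurable in the initial datum

Helper file (`--supports stmt-AtomisticToContinuum-13734`) for the crux
`Summit.AtomisticToContinuum.HydrodynamicLimit.Theses.TwoClocks.CollisionActivityTails`
(≡ `…Theses.OneFlightGossipEngine.CollisionActivityTails`), skeleton line `SketchK1`: the measurability
ENGINE behind the measurability conjunct of the registered stub `stub_crowdedActivityUI` (companion file
`…CollisionActivityTailsCrowdedActivityMeasurable`), whose functional — the crowded collisional activity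
`Fcr_i` — is a collision pair sum whose summand sees the WHOLE configuration at the collision time.

The collision-sum measurability engine of the tree
(`Literature.Analysis.FluidPDE.EmpiricalCollisionMeasureMeasurable(Labels)`: velocity-jump detection
over the `2^n` dyadic cells of the window, time-slice measurability of the flow only) handles summands
that are continuous functions of the collision MARK `(t, x_k, ω, v_k⁻, v_l⁻)` in a hard-sphere REGULAR
geometry (`ε < 1/2` on the torus). Here, verbatim the same argument for a family `H k l` of continuous
functions of `(time, configuration, configuration)`: the rank-`n` sums `cfgSumApprox` of
`H k l (r, γ r, γ l)` over the dyadic cells `(l, r]` and the ordered pairs `k ≠ l` both of whose velocities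
differ at `l` and `r` converge, along every hard-sphere trajectory in a Hausdorff position space, to the
collision pair sum of `H k l (t, γ t, γ(t⁻))` over the collisions in the window (`tendsto_cfgSumApprox`:
on a fine cell the right end carries the post-collisional velocities, and positions converging to those
at the collision; the left end the exact pre-collisional velocities,
`IsHardSphereTrajectory.collidePair_vel_eq`, and positions converging too; the pre-collisional
configuration is the left limit, `IsHardSphereTrajectory.leftLim_eq_collidePair`). Binary collisions in
ordered form need only the SYMMETRY of the contact relation (`contactPairs_eq_pair_of_symm`), which on the
flat torus holds at EVERY diameter (`Torus.euclidDist_comm`, `torus_contact_symm`) — no bound on `ε`.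
Hence the collision pair sum, extended by `0` off the good set, is measurable in the datum
(`measurable_indicator_collisionPairSum_cfg`, torus form `…_torus`, packaged as
`CfgCollisionSumMeasurable` / `stub_cfgCollisionSumMeasurable`). Cells and meshes (`meshPt`,
`cellIndex`, `eventually_fine`, `sum_sum_ite_mem_eq`, …) are the tree's, reused not copied.

References: I. Gallagher, L. Saint-Raymond, B. Texier, *From Newton to Boltzmann* (2013), §4.1,
Prop. 4.1.1 (collisions of the hard-sphere flow: time, ordered pair, velocities); M. Pulvirenti,
S. Simonella, *On the evolution of the empirical measure for the hard-sphere dynamics*,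
arXiv:1504.03215 (2015), §3 (collision sums along one trajectory).
-/

noncomputable section

open MeasureTheory Set Filter Topology Function

namespace Summit.AtomisticToContinuum.HydrodynamicLimit.Theorems.CollisionActivityTailsCfgCollisionSums

open Literature.Analysis.FluidPDE

/-! ## §1 The configuration-aware dyadic engine -/

section Engine

variable {d : Type*} [Fintype d] {X : Type*} {N : ℕ}

/-- The **configuration-aware velocity-jump sum** over the cell `(l, r]`: the sum of
`H i j (r, γ r, γ l)` over the ordered pairs `i ≠ j` of particles both of whose velocities differ at
times `l` and `r`. -/
def cfgJumpSum (γ : ℝ → Config N d X) (H : Fin N → Fin N → ℝ × Config N d X × Config N d X → ℝ)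
    (l r : ℝ) : ℝ :=
  ∑ i, ∑ j, if i ≠ j ∧ (γ r i).2 ≠ (γ l i).2 ∧ (γ r j).2 ≠ (γ l j).2 then H i j (r, γ r, γ l) else 0

/-- The rank-`n` **configuration-aware dyadic approximation** of a collision pair sum over `(a, b]`. -/
def cfgSumApprox (γ : ℝ → Config N d X) (H : Fin N → Fin N → ℝ × Config N d X × Config N d X → ℝ)
    (a b : ℝ) (n : ℕ) : ℝ :=
  ∑ k ∈ Finset.range (2 ^ n), cfgJumpSum γ H (meshPt a b n k) (meshPt a b n (k + 1))

variable [TopologicalSpace X] {G : Geometry d X} {ε : ℝ} {γ : ℝ → Config N d X}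

/-- With a symmetric contact relation the ordered contact pairs at a collision of `(p, q)` of a
hard-sphere trajectory are exactly `(p, q)` and `(q, p)`. -/
theorem contactPairs_eq_pair_of_symm (h : IsHardSphereTrajectory G ε N γ)
    (hsymm : ∀ x y : X, ‖G.sepVec x y‖ = ε → ‖G.sepVec y x‖ = ε)
    {t : ℝ} {p q : Fin N} (hpq : (p, q) ∈ contactPairs G ε (γ t)) :
    contactPairs G ε (γ t) = {(p, q), (q, p)} := by
  ext e
  rw [Finset.mem_insert, Finset.mem_singleton]
  refine ⟨h.eq_or_eq_of_mem_contactPairs hpq, ?_⟩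
  rintro (rfl | rfl)
  · exact hpq
  · obtain ⟨hne, hc⟩ := mem_contactPairs.1 hpq
    exact mem_contactPairs.2 ⟨hne.symm, mem_contactSet.2
      ⟨(mem_contactSet.1 hc).1, hsymm _ _ (mem_contactSet.1 hc).2⟩⟩

variable (H : Fin N → Fin N → ℝ × Config N d X × Config N d X → ℝ)

/-- **The configuration-aware velocity-jump sum on a fine cell.** If every collision time in the
cell `(l, r]` equals `s ∈ (l, r]`, the sum over the cell is the sum of `H i j (r, γ r, γ l)` over the
ordered contact pairs at time `s`. -/
theorem cfgJumpSum_eq (h : IsHardSphereTrajectory G ε N γ)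
    (hsymm : ∀ x y : X, ‖G.sepVec x y‖ = ε → ‖G.sepVec y x‖ = ε)
    {l r s : ℝ} (hs : s ∈ Ioc l r) (hsub : ∀ t ∈ collisionTimes G ε γ, t ∈ Ioc l r → t = s) :
    cfgJumpSum γ H l r = ∑ p ∈ contactPairs G ε (γ s), H p.1 p.2 (r, γ r, γ l) := by
  classical
  -- free flight on `(s, r]`
  have hsr : ∀ k, (γ r k).2 = (γ s k).2 := by
    intro k
    rw [h.free s r hs.2 (fun τ hτ hcol => ?_), freeFlight_apply]
    have := hsub τ hcol ⟨hs.1.trans hτ.1, hτ.2⟩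
    linarith [hτ.1]
  by_cases hcol : s ∈ collisionTimes G ε γ
  · obtain ⟨p, q, hpq, hc⟩ := hcol
    have hpmem : (p, q) ∈ contactPairs G ε (γ s) := mem_contactPairs.2 ⟨hpq, hc⟩
    have hpre : ∀ k, (collidePair G p q (γ s) k).2 = (γ l k).2 :=
      h.collidePair_vel_eq hs.1 (fun τ hτ hcol => by
        have := hsub τ hcol ⟨hτ.1, hτ.2.le.trans hs.2⟩
        linarith [hτ.2]) hpq hc
    have hjump : ∀ k, (γ r k).2 ≠ (γ l k).2 ↔ k = p ∨ k = q := fun k => by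
      rw [hsr k, ← hpre k]
      exact h.vel_ne_collidePair_iff hpq hc k
    rw [cfgJumpSum, contactPairs_eq_pair_of_symm h hsymm hpmem]
    rw [← sum_sum_ite_mem_eq (S := {(p, q), (q, p)}) fun i j => H i j (r, γ r, γ l)]
    refine Finset.sum_congr rfl fun i _ => Finset.sum_congr rfl fun j _ => ?_
    refine if_congr ?_ rfl rfl
    rw [hjump i, hjump j, Finset.mem_insert, Finset.mem_singleton, Prod.mk.injEq, Prod.mk.injEq]
    constructor
    · rintro ⟨hij, hi | hi, hj | hj⟩ <;> subst hi <;> subst hj <;> tauto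
    · rintro (⟨rfl, rfl⟩ | ⟨rfl, rfl⟩)
      · exact ⟨hpq, Or.inl rfl, Or.inr rfl⟩
      · exact ⟨hpq.symm, Or.inr rfl, Or.inl rfl⟩
  · rw [contactPairs_eq_empty_of_not_mem hcol, Finset.sum_empty]
    refine Finset.sum_eq_zero fun i _ => Finset.sum_eq_zero fun j _ => if_neg fun hij => hij.2.1 ?_
    rw [hsr i, h.free l s hs.1.le (fun τ hτ hc' => ?_), freeFlight_apply]
    rcases hτ.2.eq_or_lt with rfl | hlt'
    · exact hcol hc'
    · have := hsub τ hc' ⟨hτ.1, hτ.2.trans hs.2⟩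
      linarith

/-- **The configuration-aware velocity-jump sum of one cell of a fine mesh** is the sum, over the
collision times of the window with that cell index (at most one), of `H i j (r, γ r, γ l)` over their
ordered contact pairs. -/
theorem cfgJumpSum_cell_eq (h : IsHardSphereTrajectory G ε N γ)
    (hsymm : ∀ x y : X, ‖G.sepVec x y‖ = ε → ‖G.sepVec y x‖ = ε)
    {a b : ℝ} (hab : a < b) (hfin : (collisionTimes G ε γ ∩ Ioc a b).Finite) {n : ℕ}
    (hfine : ∀ s ∈ hfin.toFinset, ∀ s' ∈ hfin.toFinset, s ≠ s' → (b - a) / 2 ^ n < |s - s'|)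
    {k : ℕ} (hk : k < 2 ^ n) :
    cfgJumpSum γ H (meshPt a b n k) (meshPt a b n (k + 1)) =
      ∑ s ∈ hfin.toFinset with cellIndex a b n s = k, ∑ p ∈ contactPairs G ε (γ s),
        H p.1 p.2 (meshPt a b n (k + 1), γ (meshPt a b n (k + 1)), γ (meshPt a b n k)) := by
  have hmesh : 0 < (b - a) / 2 ^ n := div_pos (sub_pos.2 hab) (by positivity)
  have hcell : meshPt a b n k < meshPt a b n (k + 1) := by rw [meshPt_succ]; linarith
  rcases (hfin.toFinset.filter fun s => cellIndex a b n s = k).eq_empty_or_nonempty with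
    he | ⟨s₀, hs₀⟩
  · rw [he, Finset.sum_empty]
    have hno : ∀ t ∈ collisionTimes G ε γ, t ∉ Ioc (meshPt a b n k) (meshPt a b n (k + 1)) := by
      intro t ht htk
      obtain ⟨hT, hidx⟩ := IsHardSphereTrajectory.mem_toFinset_of_mem_cell hab hfin hk ht htk
      have : t ∈ hfin.toFinset.filter fun s => cellIndex a b n s = k :=
        Finset.mem_filter.2 ⟨hT, hidx⟩
      rw [he] at this
      exact Finset.notMem_empty t this
    rw [cfgJumpSum_eq H h hsymm (s := meshPt a b n (k + 1)) ⟨hcell, le_rfl⟩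
      (fun t ht htk => absurd htk (hno t ht)), contactPairs_eq_empty_of_not_mem
      (fun hc => hno _ hc ⟨hcell, le_rfl⟩), Finset.sum_empty]
  · obtain ⟨hs₀T, hidx₀⟩ := Finset.mem_filter.1 hs₀
    have hs₀cell : s₀ ∈ Ioc (meshPt a b n k) (meshPt a b n (k + 1)) := by
      have := (mem_cell_cellIndex hab n (hfin.mem_toFinset.1 hs₀T).2).2
      rwa [hidx₀] at this
    have huniq : ∀ t ∈ collisionTimes G ε γ,
        t ∈ Ioc (meshPt a b n k) (meshPt a b n (k + 1)) → t = s₀ := by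
      intro t ht htk
      by_contra hne
      have hT := (IsHardSphereTrajectory.mem_toFinset_of_mem_cell hab hfin hk ht htk).1
      exact (lt_irrefl _) ((hfine t hT s₀ hs₀T hne).trans (sub_lt_of_mem_cell htk hs₀cell))
    have hfilter : (hfin.toFinset.filter fun s => cellIndex a b n s = k) = {s₀} := by
      refine Finset.eq_singleton_iff_unique_mem.2 ⟨hs₀, fun t ht => ?_⟩
      obtain ⟨htT, hidx⟩ := Finset.mem_filter.1 ht
      have htcell : t ∈ Ioc (meshPt a b n k) (meshPt a b n (k + 1)) := by
        have := (mem_cell_cellIndex hab n (hfin.mem_toFinset.1 htT).2).2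
        rwa [hidx] at this
      exact huniq t (hfin.mem_toFinset.1 htT).1 htcell
    rw [hfilter, Finset.sum_singleton]
    exact cfgJumpSum_eq H h hsymm hs₀cell huniq

/-- **Convergence of the configuration-aware dyadic approximation.** Along a hard-sphere trajectory
(Hausdorff position space, symmetric contact relation), for a family `H i j` of continuous functions
of `(time, configuration, configuration)`, the rank-`n` approximation over `(a, b]` converges to the
collision pair sum of `H i j (t, γ t, γ(t⁻))` (post-collisional configuration `γ t`, pre-collisional
configuration the left limit `Function.leftLim γ t`) over the ordered contact pairs of the collisions in
`(a, b]`: finitely many collisions, each eventually alone in its cell; the right end of the cell carries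
the post-collisional velocities and positions converging to those at the collision, the left end the
pre-collisional velocities. -/
theorem tendsto_cfgSumApprox [T2Space X] (h : IsHardSphereTrajectory G ε N γ)
    (hsymm : ∀ x y : X, ‖G.sepVec x y‖ = ε → ‖G.sepVec y x‖ = ε) {a b : ℝ} (hab : a < b)
    (hH : ∀ i j, Continuous (H i j)) :
    Tendsto (fun n => cfgSumApprox γ H a b n) atTop
      (𝓝 (collisionPairSum G ε γ (Ioc a b) fun t i j => H i j (t, γ t, leftLim γ t))) := by
  have hfin : (collisionTimes G ε γ ∩ Ioc a b).Finite :=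
    h.finite_collisionTimes_inter_of_subset_Icc Ioc_subset_Icc_self
  rw [collisionPairSum_eq_finset_sum hfin]
  have hfine := IsHardSphereTrajectory.eventually_fine hfin a b
  -- the approximants, rewritten as sums over the collision times
  have happrox : ∀ᶠ n in atTop, (∑ s ∈ hfin.toFinset, ∑ p ∈ contactPairs G ε (γ s),
      H p.1 p.2 (meshPt a b n (cellIndex a b n s + 1), γ (meshPt a b n (cellIndex a b n s + 1)),
        γ (meshPt a b n (cellIndex a b n s)))) = cfgSumApprox γ H a b n := by
    filter_upwards [hfine] with n hn
    have hmaps : ∀ s ∈ hfin.toFinset, cellIndex a b n s ∈ Finset.range (2 ^ n) := fun s hs =>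
      Finset.mem_range.2 (mem_cell_cellIndex hab n (hfin.mem_toFinset.1 hs).2).1
    symm
    calc cfgSumApprox γ H a b n
        = ∑ k ∈ Finset.range (2 ^ n), ∑ s ∈ hfin.toFinset with cellIndex a b n s = k,
            ∑ p ∈ contactPairs G ε (γ s),
              H p.1 p.2 (meshPt a b n (k + 1), γ (meshPt a b n (k + 1)), γ (meshPt a b n k)) :=
          Finset.sum_congr rfl fun k hk =>
            cfgJumpSum_cell_eq H h hsymm hab hfin hn (Finset.mem_range.1 hk)
      _ = ∑ k ∈ Finset.range (2 ^ n), ∑ s ∈ hfin.toFinset with cellIndex a b n s = k,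
            ∑ p ∈ contactPairs G ε (γ s),
              H p.1 p.2 (meshPt a b n (cellIndex a b n s + 1),
                γ (meshPt a b n (cellIndex a b n s + 1)), γ (meshPt a b n (cellIndex a b n s))) :=
          Finset.sum_congr rfl fun k _ => Finset.sum_congr rfl fun s hs => by
            rw [(Finset.mem_filter.1 hs).2]
      _ = _ := Finset.sum_fiberwise_of_maps_to hmaps _
  refine Tendsto.congr' happrox (tendsto_finsetSum _ fun s hs => tendsto_finsetSum _ fun p hp => ?_)
  -- convergence of each term
  obtain ⟨-, hsI⟩ := hfin.mem_toFinset.1 hs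
  have hcell := fun n => (mem_cell_cellIndex hab n hsI).2
  have hmesh : ∀ n, meshPt a b n (cellIndex a b n s + 1) =
      meshPt a b n (cellIndex a b n s) + (b - a) / 2 ^ n := fun n => meshPt_succ a b n _
  have hr' : Tendsto (fun n => meshPt a b n (cellIndex a b n s + 1)) atTop (𝓝 s) := by
    refine tendsto_of_tendsto_of_tendsto_of_le_of_le tendsto_const_nhds
      (by simpa using (tendsto_meshSize a b).const_add s) (fun n => (hcell n).2) fun n => ?_
    have := (hcell n).1
    rw [hmesh n]
    linarith
  have hl' : Tendsto (fun n => meshPt a b n (cellIndex a b n s)) atTop (𝓝 s) := by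
    have h1 : Tendsto (fun n => meshPt a b n (cellIndex a b n s + 1) - (b - a) / 2 ^ n) atTop
        (𝓝 (s - 0)) := hr'.sub (tendsto_meshSize a b)
    rw [sub_zero] at h1
    refine h1.congr fun n => ?_
    rw [hmesh n]
    ring
  -- in a fine mesh the rest of the cell of `s` is collision-free
  have hfree : ∀ᶠ n in atTop, ∀ τ ∈ collisionTimes G ε γ,
      τ ∈ Ioc (meshPt a b n (cellIndex a b n s)) (meshPt a b n (cellIndex a b n s + 1)) → τ = s := by
    filter_upwards [hfine] with n hn τ hτ hτcell
    by_contra hne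
    have hidx := (mem_cell_cellIndex hab n hsI).1
    have hT := (IsHardSphereTrajectory.mem_toFinset_of_mem_cell hab hfin hidx hτ hτcell).1
    exact (lt_irrefl _) ((hn τ hT s hs hne).trans (sub_lt_of_mem_cell hτcell (hcell n)))
  have hfreel : ∀ᶠ n in atTop, ∀ τ ∈ Ioo (meshPt a b n (cellIndex a b n s)) s,
      τ ∉ collisionTimes G ε γ := by
    filter_upwards [hfree] with n hn τ hτ hτC
    have := hn τ hτC ⟨hτ.1, hτ.2.le.trans (hcell n).2⟩
    linarith [hτ.2]
  have hfreer : ∀ᶠ n in atTop, ∀ τ ∈ Ioc s (meshPt a b n (cellIndex a b n s + 1)),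
      τ ∉ collisionTimes G ε γ := by
    filter_upwards [hfree] with n hn τ hτ hτC
    have := hn τ hτC ⟨(hcell n).1.trans hτ.1, hτ.2⟩
    linarith [hτ.1]
  obtain ⟨i, j⟩ := p
  obtain ⟨hij, hc⟩ := mem_contactPairs.1 hp
  -- the configuration after the collision: `γ (r n) → γ s`
  have hγr : Tendsto (fun n => γ (meshPt a b n (cellIndex a b n s + 1))) atTop (𝓝 (γ s)) := by
    rw [tendsto_pi_nhds]
    intro k
    rw [Prod.tendsto_iff]
    refine ⟨((h.pos_continuous k).tendsto s).comp hr', tendsto_const_nhds.congr' ?_⟩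
    filter_upwards [hfreer] with n hn
    show (γ s k).2 = (γ (meshPt a b n (cellIndex a b n s + 1)) k).2
    rw [h.free s _ (hcell n).2 hn, freeFlight_apply]
  -- the configuration before the collision: `γ (l n) → γ(s⁻) = collidePair G i j (γ s)`
  have hγl : Tendsto (fun n => γ (meshPt a b n (cellIndex a b n s))) atTop (𝓝 (leftLim γ s)) := by
    rw [h.leftLim_eq_collidePair hij hc, tendsto_pi_nhds]
    intro k
    rw [Prod.tendsto_iff]
    refine ⟨?_, tendsto_const_nhds.congr' ?_⟩
    · rw [collidePair_apply_fst]
      exact ((h.pos_continuous k).tendsto s).comp hl'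
    · filter_upwards [hfreel] with n hn
      exact h.collidePair_vel_eq (hcell n).1 hn hij hc k
  exact ((hH i j).tendsto _).comp (hr'.prodMk_nhds (hγr.prodMk_nhds hγl))

end Engine

section FlowEngine

variable {d : Type*} [Fintype d] {X : Type*} {N : ℕ} [MeasureSpace X] [TopologicalSpace X]
  {G : Geometry d X} {ε : ℝ} (Φ : HardSphereFlow G ε N)
  {H : Fin N → Fin N → ℝ × Config N d X × Config N d X → ℝ}

/-- The configuration-aware velocity-jump sum over a fixed cell, read off the orbit of `z`, is
measurable in `z` (point evaluations of the flow at the two fixed times only). -/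
theorem measurable_cfgJumpSum (hH : ∀ i j, Measurable (H i j)) (l r : ℝ) :
    Measurable fun z => cfgJumpSum (fun t => Φ.flow t z) H l r := by
  unfold cfgJumpSum
  refine Finset.measurable_sum _ fun i _ => Finset.measurable_sum _ fun j _ => ?_
  have hv : ∀ (t : ℝ) (k : Fin N), Measurable fun z : Config N d X => (Φ.flow t z k).2 :=
    fun t k => ((measurable_pi_apply k).comp (Φ.measurable_flow t)).snd
  refine Measurable.ite ?_ ((hH i j).comp (measurable_const.prodMk
    ((Φ.measurable_flow r).prodMk (Φ.measurable_flow l)))) measurable_const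
  exact (MeasurableSet.const _).inter (((measurableSet_eq_fun (hv r i) (hv l i)).compl).inter
    (measurableSet_eq_fun (hv r j) (hv l j)).compl)

/-- The rank-`n` configuration-aware approximation, read off the orbit, is measurable in `z`. -/
theorem measurable_cfgSumApprox (hH : ∀ i j, Measurable (H i j)) (a b : ℝ) (n : ℕ) :
    Measurable fun z => cfgSumApprox (fun t => Φ.flow t z) H a b n :=
  Finset.measurable_sum _ fun _ _ => measurable_cfgJumpSum Φ hH _ _

/-- **Measurability of configuration-dependent collision pair sums in the initial datum.** Along a
hard-sphere flow (Hausdorff position space, symmetric contact relation), for a family `H i j` of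
continuous and measurable functions of `(time, configuration, configuration)`, the collision pair sum
`z ↦ Σ_{collisions (t, i, j) of the orbit of z in (a, b]} H i j (t, Φ_t z, Φ_{t⁻} z)`, extended by `0`
off the good set, is measurable (pointwise limit of the measurable dyadic approximations; only the
time-slice measurability `Φ.measurable_flow` is used). -/
theorem measurable_indicator_collisionPairSum_cfg [T2Space X]
    (hsymm : ∀ x y : X, ‖G.sepVec x y‖ = ε → ‖G.sepVec y x‖ = ε)
    (hHc : ∀ i j, Continuous (H i j)) (hHm : ∀ i j, Measurable (H i j)) (a b : ℝ) :
    Measurable (Φ.good.indicator fun z => collisionPairSum G ε (fun t => Φ.flow t z) (Ioc a b)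
      fun t i j => H i j (t, Φ.flow t z, leftLim (fun t' => Φ.flow t' z) t)) := by
  by_cases hab : a < b
  · refine measurable_of_tendsto_metrizable (f := fun n => Φ.good.indicator fun z =>
      cfgSumApprox (fun t => Φ.flow t z) H a b n)
      (fun n => (measurable_cfgSumApprox Φ hHm a b n).indicator Φ.measurableSet_good) ?_
    rw [tendsto_pi_nhds]
    intro z
    by_cases hz : z ∈ Φ.good
    · simp only [indicator_of_mem hz]
      exact tendsto_cfgSumApprox H (Φ.isTrajectory z hz) hsymm hab hHc
    · simp only [indicator_of_notMem hz]
      exact tendsto_const_nhds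
  · have h0 : (fun z => collisionPairSum G ε (fun t => Φ.flow t z) (Ioc a b)
        fun t i j => H i j (t, Φ.flow t z, leftLim (fun t' => Φ.flow t' z) t)) = fun _ => 0 := by
      funext z
      rw [Ioc_eq_empty hab, collisionPairSum_empty]
    rw [h0]
    exact measurable_const.indicator Φ.measurableSet_good

end FlowEngine

/-! ## §2 On the flat torus: every diameter -/

section TorusGeometry

variable {d : Type*} [Fintype d] {N : ℕ} {ε : ℝ}

/-- On the flat torus contact is symmetric at EVERY diameter (the minimal-image distance is
symmetric, `Torus.euclidDist_comm`; no bound `ε < 1/2` is needed for this). -/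
theorem torus_contact_symm (ε : ℝ) :
    ∀ x y : UnitAddTorus d, ‖(Torus.geometry d).sepVec x y‖ = ε →
      ‖(Torus.geometry d).sepVec y x‖ = ε := by
  intro x y h
  rw [Torus.norm_geometry_sepVec] at h ⊢
  rwa [Torus.euclidDist_comm]

/-- **On `T^d`, any diameter**: a collision pair sum over `(a, b]` along the flow with a continuous and
measurable configuration-dependent family of summands, extended by `0` off the good set, is measurable
in the initial datum. -/
theorem measurable_indicator_collisionPairSum_cfg_torus (Φ : HardSphereFlow (Torus.geometry d) ε N)
    {H : Fin N → Fin N →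
      ℝ × Config N d (UnitAddTorus d) × Config N d (UnitAddTorus d) → ℝ}
    (hHc : ∀ i j, Continuous (H i j)) (hHm : ∀ i j, Measurable (H i j)) (a b : ℝ) :
    Measurable (Φ.good.indicator fun z => collisionPairSum (Torus.geometry d) ε (fun t => Φ.flow t z)
      (Ioc a b) fun t i j => H i j (t, Φ.flow t z, leftLim (fun t' => Φ.flow t' z) t)) :=
  measurable_indicator_collisionPairSum_cfg Φ (torus_contact_symm ε) hHc hHm a b

end TorusGeometry

/-- **CONFIGURATION-DEPENDENT COLLISION SUMS ARE MEASURABLE** (the engine's deliverable, torus form):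
for every dimension, particle number, diameter, hard-sphere flow on `T^d`, every continuous and
measurable family `H i j` of functions of `(time, configuration, configuration)` and every window
`(a, b]`, the collision pair sum `z ↦ Σ_{collisions (t, i, j) in (a, b]} H i j (t, Φ_t z, Φ_{t⁻} z)`,
extended by `0` off the good set, is measurable. -/
def CfgCollisionSumMeasurable : Prop :=
  ∀ (d : Type) [Fintype d] (N : ℕ) (ε : ℝ) (Φ : HardSphereFlow (Torus.geometry d) ε N)
    (H : Fin N → Fin N → ℝ × Config N d (UnitAddTorus d) × Config N d (UnitAddTorus d) → ℝ),
    (∀ i j, Continuous (H i j)) → (∀ i j, Measurable (H i j)) → ∀ a b : ℝ,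
    Measurable (Φ.good.indicator fun z => collisionPairSum (Torus.geometry d) ε (fun t => Φ.flow t z)
      (Ioc a b) fun t i j => H i j (t, Φ.flow t z, leftLim (fun t' => Φ.flow t' z) t))

/-- **STUB (the engine, torus form).** `CfgCollisionSumMeasurable` holds
(`measurable_indicator_collisionPairSum_cfg_torus`). -/
theorem stub_cfgCollisionSumMeasurable : CfgCollisionSumMeasurable :=
  fun _ _ _ _ Φ _ hHc hHm a b => measurable_indicator_collisionPairSum_cfg_torus Φ hHc hHm a b

end Summit.AtomisticToContinuum.HydrodynamicLimit.Theorems.CollisionActivityTailsCfgCollisionSums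

end
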